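import Literature.MathematicalPhysics.QuantumFieldTheory.Balaban1983to89.B9Eq349PerturbedQGGQInvBlockDecay
import Literature.MathematicalPhysics.QuantumFieldTheory.Balaban1983to89.B9Eq347LocalFromBlockDecay
import Literature.MathematicalPhysics.QuantumFieldTheory.Balaban1983to89.B9Eq347GlobalFromLocal

/-!
# `Balaban1983to89.B9Eq349QGGQInvSupRow` — T. Bałaban, *Propagators for lattice gauge theories in a background field*, Commun. Math. Phys. **99** (1985)
# 389–434 [Balaban1985BackgroundPropagators] Thm 3.11 p. 416 (*«the operators Δ′_a(U), …, Q′G′(U)²Q′*(U) … are positive, uniformly bounded from below …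
# the kernels … decay exponentially»*), (3.25)–(3.26) pp. 394–395, (3.49) p. 399, p. 415 (*«P = G′Q′*(Q′G′²Q′*)⁻¹Q′G′»*) and p. 426 after (3.153) (*«reduce
# properties of the operators 𝔓, 𝔊 to the corresponding properties of the operators G′, (Q′G′²Q′*)⁻¹, G₁, (QG₁Q*)⁻¹»*), with [Balaban1984PropagatorsI]
# (1.45) p. 26: **THE SUP ROW OF THE INVERSE GRAM OPERATOR `c(U) = (Q̃′G′(U)²Q̃′†)⁻¹` ON THE UNIT LATTICE — road B8″'s point-block decay in its window
# (ne9-leaf-01's `B9Eq349PerturbedQGGQInvBlockDecay.norm_point_block_greenK_le_of_window`: `‖r_{y₁}∘c(U)∘r_{y₀}‖ ≤ (σ⁻¹K∕(1−q))·e^{−κ′d_m(y₀,y₁)}`) read as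
# the letter (L) at `π = id` by this lineage's `B9Eq347LocalFromBlockDecay.local_of_point_decay_sites` (blocks = sites: NO `√(L^d)`) and summed by
# `B9Eq347GlobalFromLocal`: `‖(c(U)g)(x)‖ ≤ (σ⁻¹K∕(1−q))·e^{−κ′d_m(x,v)}·F` for `g` supported at `v`, and `‖(c(U)g)(x)‖ ≤ (σ⁻¹K∕(1−q))·K_{d+1}(κ′)·sup‖g‖` for
# every `g`** — the pub-balaban NE9 owner's plan v10 §6 OPEN (4) item «the `K̃`-row: on the UNIT lattice blocks are sites, so road B8″'s `L²` block decay of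
# `(Q′G′Q′†)⁻¹` is an entry bound — one row sum, no Kato step» (`t4/b2b-balaban-t4-ne9-p1/g90/STOREY-D-ASSEMBLY.md` §4), for the Gram operator the tree has

statement-level skeleton of published theorems with citation tags; proofs where landed; nothing here is a claim about the Yang–Mills mass gap

CITATION HEADER (lean-in-tree rule).  Audit cell `pub-balaban`, sub-cell `t4`, BINDER row NE9; filed by NE9 crux-team LEAF PROVER 03
(`b2b-balaban-t4-ne9-formalise-leaf-03`, gen 71).  Composed BY NAME: ne9-leaf-01's window theorem (EVERY binder below is ITS binder, token for token),
this lineage's (K) `local_of_point_decay_sites`, (G) `local_transport` ∕ `norm_apply_le_of_local`, the cell's `B4Sect5Torus.torusSum_le`.  Sources READ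
(renders `…1985-cmp99-background-propagators-p027∕p038`, `…-p006∕p007∕p011`): [Balaban1985BackgroundPropagators] pp. 394–395 (3.25)–(3.26), p. 399 (3.49),
p. 415, p. 416 Thm 3.11, p. 426.  NOTHING printed is asserted: the window, `σ⁻¹K`, `e`, `q` are the cell's DISPLAYED letters.

WHAT IS PROVED (sorry-free; proof lane — no `def`; [folklore] composition).  Data and window = `norm_point_block_greenK_le_of_window`'s, verbatim
(dimension `d+1`, unit torus `T_m`, carrier `SiteL2K ℂ (d+1) m c₁ W`, point family `r` by its letter, flat and perturbed positivity witnesses, the flat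
kernel letter `hb`, the perturbation entry letter `hEd`, the window `hq`):
* **`local_letter_QGGQInv`** — for every unit site `v`, every `g ∈ L²` supported at `v` with `‖g(y)‖ ≤ F`, every `x`:
  `‖(c(U)g)(x)‖ ≤ (σ⁻¹K∕(1−q))·e^{−κ′·d_m(x,v)}·F` (the letter (L) at `π = id`, through `WL2.equiv`).
* **`sup_row_QGGQInv`** (`0 < κ′`) — for EVERY `g`: `‖(c(U)g)(x)‖ ≤ (σ⁻¹K∕(1−q))·K_{d+1}(κ′)·sup_y‖g(y)‖`, `K_{d+1}` = `latticeConst`, volume-free.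
HONEST SCOPE.  A change of currency on ONE factor of the words (3.123)∕(3.153) (the Gram inverse of road B8″, NOT `(QG₁Q*)⁻¹` of (3.126), which the tree
types abstractly as `KinvK`); the window is the cell's perturbative window around the flat point (print's proof is the random-walk expansion, uniform in
`U`); no constant or rate valued.  NOT Thm 3.11, NOT NE9 (cell pub-balaban: NE9 NOT PRINTED ∕ NOT PROVED; «NE9 ⇐ the named binders»; row WALLED ON A MODEL
(O-NE9-1; #5 UNRULED); spine PROVED 0∕9; rung (B)+1 on a finite T⁴ — NOT infinite volume, NOT mass gap, NOT Clay; HONEST DEPENDENCY: continuum YM on T⁴ ⇐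
BetaPertH ∧ nine spine estimates (0/9 proved); BetaPertH ⇐ (D1) ∧ (D4) ∧ CAP+tail; G-an2-4 gates asym, D1 and NE2/3/4).  NEW file importing
`B9Eq349PerturbedQGGQInvBlockDecay`, `B9Eq347LocalFromBlockDecay`, `B9Eq347GlobalFromLocal`; nothing modified.  Net new unproved facts: 0.
-/

noncomputable section

open scoped BigOperators InnerProductSpace ComplexConjugate

namespace Literature.MathematicalPhysics.QuantumFieldTheory.Balaban1983to89.B9Eq349QGGQInvSupRow

open B4Sect5Torus (TSite tdist tdist_nonneg tdist_triangle torusSum_le)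
open B4Sect5Proof (latticeConst latticeConst_nonneg)
open B9SectCLatticeCarrier (Bond)
open B9Eq311L2Pairing (WL2)
open B9Eq319QprimeTorus (fineP)
open B11Eq103H1Complex (SiteL2K greenK)
open B9Eq326OperatorAssembly (QprimeW)
open B9Eq3119DeltaPiCarrier (laplacePrimeA GpOfU)
open B9Eq315QTorusOnto (liftSite)
open B5Torus145Decay (torusKernel145M)
open B9Eq349PerturbedQGGQInvBlockDecay (norm_point_block_greenK_le_of_window)
open B9Eq347LocalFromBlockDecay (local_of_point_decay_sites)
open B9Eq347GlobalFromLocal (local_transport norm_apply_le_of_local)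

variable {d : ℕ} (L : ℕ) [NeZero L] (m : Fin (d + 1) → ℕ) [∀ i, NeZero (m i)] [∀ i, NeZero (fineP L m i)]
  {𝔸 : Type*} [Ring 𝔸] [Algebra ℂ 𝔸] {W : Type*} [NormedAddCommGroup W] [InnerProductSpace ℂ W] [FiniteDimensional ℂ W]
  (φ : W ≃ₗ[ℂ] 𝔸) (c₀ : ℝ) [Fact (0 < c₀)] (η : ℝ) (c₁ : ℝ) [Fact (0 < c₁)]

/-- **THE LETTER (L) OF `c(U) = (Q̃′G′(U)²Q̃′†)⁻¹` ON THE UNIT LATTICE**: on road B8″'s window (binders verbatim), for every unit site `v`, every `g`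
supported at `v` with `‖g(y)‖ ≤ F` and every `x`: `‖(c(U)g)(x)‖ ≤ (σ⁻¹K∕(1−q))·e^{−κ′·d_m(x,v)}·F` — the point-block decay read pointwise, blocks = sites,
no `√(L^d)` (`B9Eq347LocalFromBlockDecay.local_of_point_decay_sites`). [cite: Balaban1985BackgroundPropagators, Thm 3.11 p.416, (3.25)-(3.26) pp.394-395, (3.49) p.399]
[cite: Balaban1984PropagatorsI, (1.45) p.26] -/
theorem local_letter_QGGQInv (hη : η ≠ 0) {a' : ℝ} (ha' : 0 < a') (U : Bond (d + 1) (fineP L m) → 𝔸ˣ)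
    (hpos1 : ∀ x : SiteL2K ℂ (d + 1) (fineP L m) c₀ W, x ≠ 0 →
      0 < RCLike.re ⟪x, laplacePrimeA L m φ η (fun _ : Bond (d + 1) (fineP L m) => (1 : 𝔸ˣ)) a' (c₁ := c₁) x⟫_ℂ)
    (hX1 : ∀ ψ : SiteL2K ℂ (d + 1) m c₁ W, ψ ≠ 0 → 0 < RCLike.re ⟪ψ, (((WL2.linearEquiv ℂ ℂ (fun _ : TSite (d + 1) m => c₁)).symm.toLinearMap ∘ₗ
          QprimeW L m φ (fun _ : Bond (d + 1) (fineP L m) => (1 : 𝔸ˣ)) (c₀ := c₀)) ∘ₗ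
        GpOfU L m φ η (fun _ : Bond (d + 1) (fineP L m) => (1 : 𝔸ˣ)) a' (c₁ := c₁) hpos1 ∘ₗ
        GpOfU L m φ η (fun _ : Bond (d + 1) (fineP L m) => (1 : 𝔸ˣ)) a' (c₁ := c₁) hpos1 ∘ₗ
        LinearMap.adjoint ((WL2.linearEquiv ℂ ℂ (fun _ : TSite (d + 1) m => c₁)).symm.toLinearMap ∘ₗ
          QprimeW L m φ (fun _ : Bond (d + 1) (fineP L m) => (1 : 𝔸ˣ)) (c₀ := c₀))) ψ⟫_ℂ)
    (hposU : ∀ x : SiteL2K ℂ (d + 1) (fineP L m) c₀ W, x ≠ 0 → 0 < RCLike.re ⟪x, laplacePrimeA L m φ η U a' (c₁ := c₁) x⟫_ℂ)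
    (hXU : ∀ ψ : SiteL2K ℂ (d + 1) m c₁ W, ψ ≠ 0 → 0 < RCLike.re ⟪ψ, (((WL2.linearEquiv ℂ ℂ (fun _ : TSite (d + 1) m => c₁)).symm.toLinearMap ∘ₗ
          QprimeW L m φ U (c₀ := c₀)) ∘ₗ GpOfU L m φ η U a' (c₁ := c₁) hposU ∘ₗ GpOfU L m φ η U a' (c₁ := c₁) hposU ∘ₗ
        LinearMap.adjoint ((WL2.linearEquiv ℂ ℂ (fun _ : TSite (d + 1) m => c₁)).symm.toLinearMap ∘ₗ QprimeW L m φ U (c₀ := c₀))) ψ⟫_ℂ)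
    {r : TSite (d + 1) m → SiteL2K ℂ (d + 1) m c₁ W →L[ℂ] SiteL2K ℂ (d + 1) m c₁ W}
    (hr : ∀ (y : TSite (d + 1) m) (f : SiteL2K ℂ (d + 1) m c₁ W) (x : TSite (d + 1) m),
      WL2.equiv ℂ (fun _ : TSite (d + 1) m => c₁) W (r y f) x = if x = y then WL2.equiv ℂ (fun _ : TSite (d + 1) m => c₁) W f x else 0)
    {K κ κ' e : ℝ} (hK0 : 0 ≤ K) (he : 0 ≤ e) (hκ' : 0 ≤ κ') (hκκ : κ' < κ)
    (hb : ∀ y y' : TSite (d + 1) m, ‖torusKernel145M L (a' * (η * L) ^ 2 * (c₁ / (c₀ * (L : ℝ) ^ (d + 1)))) m (liftSite y - liftSite y')‖ ≤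
      K * Real.exp (-(κ * tdist m y y')))
    (hEd : ∀ y₀ y₁ : TSite (d + 1) m,
      ‖r y₁ ∘L (LinearMap.toContinuousLinearMap ((((WL2.linearEquiv ℂ ℂ (fun _ : TSite (d + 1) m => c₁)).symm.toLinearMap ∘ₗ
            QprimeW L m φ U (c₀ := c₀)) ∘ₗ GpOfU L m φ η U a' (c₁ := c₁) hposU ∘ₗ GpOfU L m φ η U a' (c₁ := c₁) hposU ∘ₗ
            LinearMap.adjoint ((WL2.linearEquiv ℂ ℂ (fun _ : TSite (d + 1) m => c₁)).symm.toLinearMap ∘ₗ QprimeW L m φ U (c₀ := c₀)))) -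
          LinearMap.toContinuousLinearMap ((((WL2.linearEquiv ℂ ℂ (fun _ : TSite (d + 1) m => c₁)).symm.toLinearMap ∘ₗ
            QprimeW L m φ (fun _ : Bond (d + 1) (fineP L m) => (1 : 𝔸ˣ)) (c₀ := c₀)) ∘ₗ
            GpOfU L m φ η (fun _ : Bond (d + 1) (fineP L m) => (1 : 𝔸ˣ)) a' (c₁ := c₁) hpos1 ∘ₗ
            GpOfU L m φ η (fun _ : Bond (d + 1) (fineP L m) => (1 : 𝔸ˣ)) a' (c₁ := c₁) hpos1 ∘ₗ
            LinearMap.adjoint ((WL2.linearEquiv ℂ ℂ (fun _ : TSite (d + 1) m => c₁)).symm.toLinearMap ∘ₗ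
              QprimeW L m φ (fun _ : Bond (d + 1) (fineP L m) => (1 : 𝔸ˣ)) (c₀ := c₀))))) ∘L r y₀‖ ≤ e * Real.exp (-(κ * tdist m y₀ y₁)))
    (hq : (c₀ / c₁ * ((η * L) ^ 2 * (c₁ / (c₀ * (L : ℝ) ^ (d + 1)))) ^ 2 * (L : ℝ) ^ (d + 1))⁻¹ * K * e * latticeConst (d + 1) (κ - κ') ^ 2 < 1)
    (v : TSite (d + 1) m) (g : SiteL2K ℂ (d + 1) m c₁ W) (F : ℝ)
    (hgv : ∀ y, y ≠ v → WL2.equiv ℂ (fun _ : TSite (d + 1) m => c₁) W g y = 0)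
    (hgF : ∀ y, ‖WL2.equiv ℂ (fun _ : TSite (d + 1) m => c₁) W g y‖ ≤ F) (x : TSite (d + 1) m) :
    ‖WL2.equiv ℂ (fun _ : TSite (d + 1) m => c₁) W (greenK _ hXU g) x‖ ≤
      (c₀ / c₁ * ((η * L) ^ 2 * (c₁ / (c₀ * (L : ℝ) ^ (d + 1)))) ^ 2 * (L : ℝ) ^ (d + 1))⁻¹ * K /
          (1 - (c₀ / c₁ * ((η * L) ^ 2 * (c₁ / (c₀ * (L : ℝ) ^ (d + 1)))) ^ 2 * (L : ℝ) ^ (d + 1))⁻¹ * K * e * latticeConst (d + 1) (κ - κ') ^ 2) *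
        Real.exp (-(κ' * tdist m x v)) * F := by
  have hc₀ : 0 < c₀ := Fact.out
  have hc₁ : 0 < c₁ := Fact.out
  have hL : (0 : ℝ) < L := by exact_mod_cast Nat.pos_of_ne_zero (NeZero.ne L)
  have hm : ∀ i, 1 ≤ m i := fun i => Nat.one_le_iff_ne_zero.mpr (NeZero.ne (m i))
  have hq1 : 0 < 1 - (c₀ / c₁ * ((η * L) ^ 2 * (c₁ / (c₀ * (L : ℝ) ^ (d + 1)))) ^ 2 * (L : ℝ) ^ (d + 1))⁻¹ * K * e *
      latticeConst (d + 1) (κ - κ') ^ 2 := sub_pos.2 hq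
  have hC : 0 ≤ (c₀ / c₁ * ((η * L) ^ 2 * (c₁ / (c₀ * (L : ℝ) ^ (d + 1)))) ^ 2 * (L : ℝ) ^ (d + 1))⁻¹ * K /
          (1 - (c₀ / c₁ * ((η * L) ^ 2 * (c₁ / (c₀ * (L : ℝ) ^ (d + 1)))) ^ 2 * (L : ℝ) ^ (d + 1))⁻¹ * K * e * latticeConst (d + 1) (κ - κ') ^ 2) := by
    positivity
  have h := local_of_point_decay_sites (c := c₁) hm (LinearMap.toContinuousLinearMap (greenK _ hXU)) hr hr hC
    (fun y₀ y₁ => norm_point_block_greenK_le_of_window L m φ c₀ η c₁ hη ha' U hpos1 hX1 hposU hXU hr hK0 he hκ' hκκ hb hEd hq y₀ y₁) v g F hgv hgF x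
  simpa only [LinearMap.coe_toContinuousLinearMap'] using h

/-- **THE SUP ROW OF `c(U)`** (`0 < κ′`): on the same window, for EVERY `g`: `‖(c(U)g)(x)‖ ≤ (σ⁻¹K∕(1−q))·K_{d+1}(κ′)·sup_y‖g(y)‖` — the letter summed over
the unit sites (`B9Eq347GlobalFromLocal.norm_apply_le_of_local` at `π = id`, `B4Sect5Torus.torusSum_le`, volume-free): the «K̃-row» shape of the NE9 owner's
OPEN (4) for the Gram operator of road B8″. [cite: Balaban1985BackgroundPropagators, Thm 3.11 p.416, (3.49) p.399, (3.153) p.426] [cite: Balaban1984PropagatorsII, Lemma 2.1 (2.61) p.234] -/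
theorem sup_row_QGGQInv (hη : η ≠ 0) {a' : ℝ} (ha' : 0 < a') (U : Bond (d + 1) (fineP L m) → 𝔸ˣ)
    (hpos1 : ∀ x : SiteL2K ℂ (d + 1) (fineP L m) c₀ W, x ≠ 0 →
      0 < RCLike.re ⟪x, laplacePrimeA L m φ η (fun _ : Bond (d + 1) (fineP L m) => (1 : 𝔸ˣ)) a' (c₁ := c₁) x⟫_ℂ)
    (hX1 : ∀ ψ : SiteL2K ℂ (d + 1) m c₁ W, ψ ≠ 0 → 0 < RCLike.re ⟪ψ, (((WL2.linearEquiv ℂ ℂ (fun _ : TSite (d + 1) m => c₁)).symm.toLinearMap ∘ₗ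
          QprimeW L m φ (fun _ : Bond (d + 1) (fineP L m) => (1 : 𝔸ˣ)) (c₀ := c₀)) ∘ₗ
        GpOfU L m φ η (fun _ : Bond (d + 1) (fineP L m) => (1 : 𝔸ˣ)) a' (c₁ := c₁) hpos1 ∘ₗ
        GpOfU L m φ η (fun _ : Bond (d + 1) (fineP L m) => (1 : 𝔸ˣ)) a' (c₁ := c₁) hpos1 ∘ₗ
        LinearMap.adjoint ((WL2.linearEquiv ℂ ℂ (fun _ : TSite (d + 1) m => c₁)).symm.toLinearMap ∘ₗ
          QprimeW L m φ (fun _ : Bond (d + 1) (fineP L m) => (1 : 𝔸ˣ)) (c₀ := c₀))) ψ⟫_ℂ)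
    (hposU : ∀ x : SiteL2K ℂ (d + 1) (fineP L m) c₀ W, x ≠ 0 → 0 < RCLike.re ⟪x, laplacePrimeA L m φ η U a' (c₁ := c₁) x⟫_ℂ)
    (hXU : ∀ ψ : SiteL2K ℂ (d + 1) m c₁ W, ψ ≠ 0 → 0 < RCLike.re ⟪ψ, (((WL2.linearEquiv ℂ ℂ (fun _ : TSite (d + 1) m => c₁)).symm.toLinearMap ∘ₗ
          QprimeW L m φ U (c₀ := c₀)) ∘ₗ GpOfU L m φ η U a' (c₁ := c₁) hposU ∘ₗ GpOfU L m φ η U a' (c₁ := c₁) hposU ∘ₗ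
        LinearMap.adjoint ((WL2.linearEquiv ℂ ℂ (fun _ : TSite (d + 1) m => c₁)).symm.toLinearMap ∘ₗ QprimeW L m φ U (c₀ := c₀))) ψ⟫_ℂ)
    {r : TSite (d + 1) m → SiteL2K ℂ (d + 1) m c₁ W →L[ℂ] SiteL2K ℂ (d + 1) m c₁ W}
    (hr : ∀ (y : TSite (d + 1) m) (f : SiteL2K ℂ (d + 1) m c₁ W) (x : TSite (d + 1) m),
      WL2.equiv ℂ (fun _ : TSite (d + 1) m => c₁) W (r y f) x = if x = y then WL2.equiv ℂ (fun _ : TSite (d + 1) m => c₁) W f x else 0)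
    {K κ κ' e : ℝ} (hK0 : 0 ≤ K) (he : 0 ≤ e) (hκ' : 0 ≤ κ') (hκκ : κ' < κ)
    (hb : ∀ y y' : TSite (d + 1) m, ‖torusKernel145M L (a' * (η * L) ^ 2 * (c₁ / (c₀ * (L : ℝ) ^ (d + 1)))) m (liftSite y - liftSite y')‖ ≤
      K * Real.exp (-(κ * tdist m y y')))
    (hEd : ∀ y₀ y₁ : TSite (d + 1) m,
      ‖r y₁ ∘L (LinearMap.toContinuousLinearMap ((((WL2.linearEquiv ℂ ℂ (fun _ : TSite (d + 1) m => c₁)).symm.toLinearMap ∘ₗ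
            QprimeW L m φ U (c₀ := c₀)) ∘ₗ GpOfU L m φ η U a' (c₁ := c₁) hposU ∘ₗ GpOfU L m φ η U a' (c₁ := c₁) hposU ∘ₗ
            LinearMap.adjoint ((WL2.linearEquiv ℂ ℂ (fun _ : TSite (d + 1) m => c₁)).symm.toLinearMap ∘ₗ QprimeW L m φ U (c₀ := c₀)))) -
          LinearMap.toContinuousLinearMap ((((WL2.linearEquiv ℂ ℂ (fun _ : TSite (d + 1) m => c₁)).symm.toLinearMap ∘ₗ
            QprimeW L m φ (fun _ : Bond (d + 1) (fineP L m) => (1 : 𝔸ˣ)) (c₀ := c₀)) ∘ₗ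
            GpOfU L m φ η (fun _ : Bond (d + 1) (fineP L m) => (1 : 𝔸ˣ)) a' (c₁ := c₁) hpos1 ∘ₗ
            GpOfU L m φ η (fun _ : Bond (d + 1) (fineP L m) => (1 : 𝔸ˣ)) a' (c₁ := c₁) hpos1 ∘ₗ
            LinearMap.adjoint ((WL2.linearEquiv ℂ ℂ (fun _ : TSite (d + 1) m => c₁)).symm.toLinearMap ∘ₗ
              QprimeW L m φ (fun _ : Bond (d + 1) (fineP L m) => (1 : 𝔸ˣ)) (c₀ := c₀))))) ∘L r y₀‖ ≤ e * Real.exp (-(κ * tdist m y₀ y₁)))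
    (hq : (c₀ / c₁ * ((η * L) ^ 2 * (c₁ / (c₀ * (L : ℝ) ^ (d + 1)))) ^ 2 * (L : ℝ) ^ (d + 1))⁻¹ * K * e * latticeConst (d + 1) (κ - κ') ^ 2 < 1)
    (hκ0 : 0 < κ') (g : SiteL2K ℂ (d + 1) m c₁ W) (F : ℝ) (hgF : ∀ y, ‖WL2.equiv ℂ (fun _ : TSite (d + 1) m => c₁) W g y‖ ≤ F)
    (x : TSite (d + 1) m) :
    ‖WL2.equiv ℂ (fun _ : TSite (d + 1) m => c₁) W (greenK _ hXU g) x‖ ≤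
      (c₀ / c₁ * ((η * L) ^ 2 * (c₁ / (c₀ * (L : ℝ) ^ (d + 1)))) ^ 2 * (L : ℝ) ^ (d + 1))⁻¹ * K /
          (1 - (c₀ / c₁ * ((η * L) ^ 2 * (c₁ / (c₀ * (L : ℝ) ^ (d + 1)))) ^ 2 * (L : ℝ) ^ (d + 1))⁻¹ * K * e * latticeConst (d + 1) (κ - κ') ^ 2) *
        latticeConst (d + 1) κ' * F := by
  have hc₀ : 0 < c₀ := Fact.out
  have hc₁ : 0 < c₁ := Fact.out
  have hL : (0 : ℝ) < L := by exact_mod_cast Nat.pos_of_ne_zero (NeZero.ne L)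
  have hm : ∀ i, 1 ≤ m i := fun i => Nat.one_le_iff_ne_zero.mpr (NeZero.ne (m i))
  have hq1 : 0 < 1 - (c₀ / c₁ * ((η * L) ^ 2 * (c₁ / (c₀ * (L : ℝ) ^ (d + 1)))) ^ 2 * (L : ℝ) ^ (d + 1))⁻¹ * K * e *
      latticeConst (d + 1) (κ - κ') ^ 2 := sub_pos.2 hq
  have hC : 0 ≤ (c₀ / c₁ * ((η * L) ^ 2 * (c₁ / (c₀ * (L : ℝ) ^ (d + 1)))) ^ 2 * (L : ℝ) ^ (d + 1))⁻¹ * K /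
          (1 - (c₀ / c₁ * ((η * L) ^ 2 * (c₁ / (c₀ * (L : ℝ) ^ (d + 1)))) ^ 2 * (L : ℝ) ^ (d + 1))⁻¹ * K * e * latticeConst (d + 1) (κ - κ') ^ 2) := by
    positivity
  have hF : 0 ≤ F := (norm_nonneg _).trans (hgF x)
  have hloc := local_transport (id : TSite (d + 1) m → TSite (d + 1) m) (WL2.linearEquiv ℂ ℂ (fun _ : TSite (d + 1) m => c₁))
    (WL2.linearEquiv ℂ ℂ (fun _ : TSite (d + 1) m => c₁)) (greenK _ hXU)
    (rhs := fun x v F => (c₀ / c₁ * ((η * L) ^ 2 * (c₁ / (c₀ * (L : ℝ) ^ (d + 1)))) ^ 2 * (L : ℝ) ^ (d + 1))⁻¹ * K /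
      (1 - (c₀ / c₁ * ((η * L) ^ 2 * (c₁ / (c₀ * (L : ℝ) ^ (d + 1)))) ^ 2 * (L : ℝ) ^ (d + 1))⁻¹ * K * e * latticeConst (d + 1) (κ - κ') ^ 2) *
        Real.exp (-(κ' * tdist m x v)) * F)
    (fun v f F hf hf' x => by
      simpa using local_letter_QGGQInv L m φ c₀ η c₁ hη ha' U hpos1 hX1 hposU hXU hr hK0 he hκ' hκκ hb hEd hq v f F (fun y hy => by simpa using hf y hy) (fun y => by simpa using hf' y) x)
  have h := norm_apply_le_of_local (id : TSite (d + 1) m → TSite (d + 1) m) (id : TSite (d + 1) m → TSite (d + 1) m) (tdist m) _ hC hloc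
    (fun u => torusSum_le (d + 1) hm hκ0 u) (WL2.equiv ℂ (fun _ : TSite (d + 1) m => c₁) W g) hF hgF x
  simpa using h

end Literature.MathematicalPhysics.QuantumFieldTheory.Balaban1983to89.B9Eq349QGGQInvSupRow

end
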